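import Literature.MathematicalPhysics.QuantumFieldTheory.LatticeAxialGauge
import Literature.MathematicalPhysics.QuantumFieldTheory.CubeChains
import Literature.MathematicalPhysics.QuantumFieldTheory.CubicalCochainsBoxTwo
import Mathlib.GroupTheory.QuotientGroup.Basic
import HarnessLib

/-!
# The fibres of the flux map of the Villain model on a cube: integer plaquette fields with
# prescribed flux through the cubes are the translates by coboundaries of comb-gauge link fields

Support file for the duality transformation of four-dimensional `U(1)` lattice gauge theory with
the Villain action (proof programme of the named fact
`Literature.MathematicalPhysics.QuantumFieldTheory.FrohlichSpencerU1PerimeterLawD4` and of its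
corollary `Literature.Barriers.QuantumFields.AbelianDeconfinementD4`). On the cube
`B_n = [0,n)^d` (`halfOpenBox`, with its plaquettes `plaquettesIn B_n`, its edges
`AxialGauge.boxEdges`, the comb tree `AxialGauge.IsComb` and its cubes `cubesIn B_n`) the Villain
partition function is a sum over integer plaquette fields `m : plaquettesIn B_n → ℤ`
(FS82 (2.2)–(2.3)). The FLUX of `m` through the cubes, `q = dm` (`fluxMap`), is unchanged by adding
the coboundary `dℓ` of an integer link field `ℓ` (`fluxMap_dFree`), and conversely — by the relative
Poincaré lemma on the box (`CubicalCochainsBoxTwo`) — two plaquette fields with the same flux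
differ by `dℓ` for a UNIQUE `ℓ` supported on the free (non-comb) edges. Hence
(`fibreEquiv`, `tsum_eq_tsum_tsum_fibre`): summing over all integer plaquette fields is summing over
the flux classes and, inside each class, over `ℤ^{free edges}` — the sum which unfolds the compact
link angles to real Gaussian variables (`PeriodicUnfolding`). This is the combinatorial content
of the first step of every proof of the perimeter law ("transformation to the non-compact, dual
model", FS82 §2.1 (i), §2.4 (2.21)–(2.24)).

* `FreeInt d n = {free edges of B_n} → ℤ`, `extFree ℓ` (extension by `0` to all links: a
  comb-gauge link field), `dFree : FreeInt d n →+ (plaquettesIn B_n → ℤ)` (its coboundary on the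
  plaquettes of the cube), `dFree_injective`;
* `extPlaq m` (extension by `0`), `fluxMap : (plaquettesIn B_n → ℤ) →+ (cubesIn B_n → ℤ)`
  (`q = dm` on the cubes), `fluxMap_dFree : fluxMap (dFree ℓ) = 0`,
  `exists_dFree_eq_of_fluxMap_eq_zero`, `range_dFree_eq_ker_fluxMap`;
* `fibreEquiv : (plaquettesIn B_n → ℤ) ≃ ((plaquettesIn B_n → ℤ) ⧸ range dFree) × FreeInt d n` with
  `fibreEquiv_symm_apply : (ξ, ℓ) ↦ ξ.out + dFree ℓ`, the injective descended flux
  `fluxQuot`, and the resummation `tsum_eq_tsum_tsum_fibre` for absolutely summable families.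

Everything is proved; no named fact is introduced.

## References

* J. Fröhlich, T. Spencer, Comm. Math. Phys. 83 (1982) 411–454, §2.1 (i), §2.4 (2.21)–(2.24).
  [FrohlichSpencerCMP1982]
-/

noncomputable section

open Finset Function
open Literature.Probability.LatticeModels

namespace Literature.MathematicalPhysics.QuantumFieldTheory

/-- Sites of `ℤ^d` (the namespace-local `Site` is the torus one). -/
local notation "ZSite" => Literature.Probability.LatticeModels.Site

namespace VillainFibre

open AxialGauge LatticeForm

variable {d n : ℕ}

/-! ### The cube as a box `[0, n-1]` -/

/-- The corner `(n-1, …, n-1)`. [folklore] -/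
def top (d n : ℕ) : ZSite d := fun _ => (n : ℤ) - 1

/-- `B_n = [0, n-1]` coordinatewise. [folklore] -/
theorem mem_halfOpenBox_iff_mem_Icc {x : ZSite d} :
    x ∈ halfOpenBox d n ↔ x ∈ Set.Icc (0 : ZSite d) (top d n) := by
  rw [mem_halfOpenBox, Set.mem_Icc, Pi.le_def, Pi.le_def]
  simp only [Pi.zero_apply, top]
  constructor
  · intro h; exact ⟨fun i => (h i).1, fun i => by have := (h i).2; omega⟩
  · intro h i; exact ⟨h.1 i, by have := h.2 i; omega⟩

/-- An edge of `ℤ^d` sticking out of an edge of the box sticks out of the box: if `x` and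
`x + eᵢ + eⱼ` are in `B_n` then so are `x + eᵢ` and `x + eⱼ`. [folklore] -/
theorem mem_halfOpenBox_add_of_mem {x : ZSite d} {i j : Fin d} (hx : x ∈ halfOpenBox d n)
    (hxij : x + e i + e j ∈ halfOpenBox d n) : x + e i ∈ halfOpenBox d n ∧ x + e j ∈ halfOpenBox d n := by
  rw [mem_halfOpenBox] at hx hxij ⊢
  rw [mem_halfOpenBox]
  refine ⟨fun k => ?_, fun k => ?_⟩ <;>
  · have h1 := hx k; have h2 := hxij k
    simp only [Pi.add_apply, LatticeForm.e, Pi.single_apply] at h1 h2 ⊢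
    split_ifs at h2 ⊢ <;> omega

/-- Membership of a plaquette of the cube in terms of its extreme corners. [folklore] -/
theorem mem_plaquettesIn_iff {x : ZSite d} {i j : Fin d} :
    (x, i, j) ∈ plaquettesIn (halfOpenBox d n) ↔
      i < j ∧ x ∈ halfOpenBox d n ∧ x + e i + e j ∈ halfOpenBox d n := by
  rw [Plaq.mem_plaquettesIn]
  constructor
  · rintro ⟨h1, h2, -, -, h5⟩; exact ⟨h2, h1, h5⟩
  · rintro ⟨h1, h2, h3⟩
    obtain ⟨h4, h5⟩ := mem_halfOpenBox_add_of_mem h2 h3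
    exact ⟨h2, h1, h4, h5, h3⟩

/-! ### Free integer link fields and their coboundary on the plaquettes of the cube -/

variable (d n) in
/-- Integer fields on the free (non-comb) edges of `B_n` (the pure-gauge integers of the Villain
model in the comb gauge). [cite: FrohlichSpencerCMP1982, §2.4 (2.22)–(2.24)] -/
abbrev FreeInt : Type := {e : ↥(boxEdges d n) // ¬ IsComb e.1} → ℤ

/-- Extension of a free integer link field by `0` to all links of `ℤ^d` (a comb-gauge link field
supported on the edges of the cube). [folklore] -/
def extFree (ℓ : FreeInt d n) : ZSite d → Fin d → ℤ := fun x i =>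
  if h : (x, i) ∈ boxEdges d n then (if hc : IsComb (x, i) then 0 else ℓ ⟨⟨(x, i), h⟩, hc⟩) else 0

/-- `extFree` is additive. [folklore] -/
theorem extFree_add (ℓ ℓ' : FreeInt d n) : extFree (ℓ + ℓ') = extFree ℓ + extFree ℓ' := by
  funext x i
  simp only [extFree, Pi.add_apply]
  split_ifs <;> simp

/-- `extFree ℓ` is in the comb gauge based at `0`. [folklore] -/
theorem extFree_comb (ℓ : FreeInt d n) (x : ZSite d) (i : Fin d)
    (hx : ∀ m : Fin d, i.val < m.val → x m = (0 : ZSite d) m) : extFree ℓ x i = 0 := by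
  simp only [extFree]
  split_ifs with h hc
  · rfl
  · exact absurd (fun k hk => hx k hk) hc
  · rfl

/-- `extFree ℓ` vanishes off the edges of the cube. [folklore] -/
theorem extFree_eq_zero_of_not_mem (ℓ : FreeInt d n) {x : ZSite d} {i : Fin d}
    (h : (x, i) ∉ boxEdges d n) : extFree ℓ x i = 0 := by
  simp [extFree, h]

/-- `extFree ℓ` on a free edge. [folklore] -/
theorem extFree_apply (ℓ : FreeInt d n) (e : {e : ↥(boxEdges d n) // ¬ IsComb e.1}) :
    extFree ℓ e.1.1.1 e.1.1.2 = ℓ e := by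
  obtain ⟨⟨⟨x, i⟩, h⟩, hc⟩ := e
  simp [extFree, h, hc]

/-- `d₁` is additive. [folklore] -/
theorem d₁_add (θ θ' : ZSite d → Fin d → ℤ) : d₁ (θ + θ') = d₁ θ + d₁ θ' := by
  funext x i j; simp only [d₁, Pi.add_apply]; ring

/-- **The coboundary of a free integer link field on the plaquettes of the cube** (the pure-gauge
part `dℓ` of the Villain integers). [cite: FrohlichSpencerCMP1982, §2.4 (2.22)–(2.24)] -/
def dFree : FreeInt d n →+ (↥(plaquettesIn (halfOpenBox d n)) → ℤ) where
  toFun ℓ p := d₁ (extFree ℓ) p.1.1 p.1.2.1 p.1.2.2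
  map_zero' := by
    funext p
    have : extFree (0 : FreeInt d n) = 0 := by funext x i; simp [extFree]
    simp [this, d₁]
  map_add' ℓ ℓ' := by funext p; simp [extFree_add, d₁_add]

/-- Unfolding `dFree`. [folklore] -/
theorem dFree_apply (ℓ : FreeInt d n) (p : ↥(plaquettesIn (halfOpenBox d n))) :
    dFree ℓ p = d₁ (extFree ℓ) p.1.1 p.1.2.1 p.1.2.2 := rfl

/-- **`ℓ ↦ dℓ` is injective on free (comb-gauge) link fields** (uniqueness in the comb gauge,
`LatticeForm.d₁_injective_of_comb`). [folklore] -/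
theorem dFree_injective : Function.Injective (dFree (d := d) (n := n)) := by
  intro ℓ ℓ' h
  have key := d₁_injective_of_comb (extFree ℓ) (extFree ℓ') 0 (top d n) (extFree_comb ℓ)
    (extFree_comb ℓ') (fun x i j hij hx hxij => by
      have hp : (x, i, j) ∈ plaquettesIn (halfOpenBox d n) :=
        mem_plaquettesIn_iff.2 ⟨hij, mem_halfOpenBox_iff_mem_Icc.2 hx, mem_halfOpenBox_iff_mem_Icc.2 hxij⟩
      have := congrFun h ⟨(x, i, j), hp⟩
      simpa [dFree_apply] using this)
  funext e
  obtain ⟨⟨⟨x, i⟩, he⟩, hc⟩ := e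
  have hx := mem_boxEdges.1 he
  have := key x i (mem_halfOpenBox_iff_mem_Icc.1 hx.1) (mem_halfOpenBox_iff_mem_Icc.1 hx.2)
  rwa [extFree_apply ℓ ⟨⟨(x, i), he⟩, hc⟩, extFree_apply ℓ' ⟨⟨(x, i), he⟩, hc⟩] at this

/-! ### The flux through the cubes -/

/-- Extension of an integer plaquette field of the cube by `0` (as a 2-cochain on the increasing
pairs). [folklore] -/
def extPlaq (m : ↥(plaquettesIn (halfOpenBox d n)) → ℤ) : ZSite d → Fin d → Fin d → ℤ :=
  fun x i j => if h : (x, i, j) ∈ plaquettesIn (halfOpenBox d n) then m ⟨(x, i, j), h⟩ else 0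

/-- `extPlaq` is additive. [folklore] -/
theorem extPlaq_add (m m' : ↥(plaquettesIn (halfOpenBox d n)) → ℤ) :
    extPlaq (m + m') = extPlaq m + extPlaq m' := by
  funext x i j; simp only [extPlaq, Pi.add_apply]; split_ifs <;> simp

/-- `extPlaq m` on a plaquette of the cube. [folklore] -/
theorem extPlaq_apply (m : ↥(plaquettesIn (halfOpenBox d n)) → ℤ) {x : ZSite d} {i j : Fin d}
    (h : (x, i, j) ∈ plaquettesIn (halfOpenBox d n)) : extPlaq m x i j = m ⟨(x, i, j), h⟩ := by
  simp [extPlaq, h]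

/-- `d₂` is additive. [folklore] -/
theorem d₂_add (ω ω' : ZSite d → Fin d → Fin d → ℤ) : d₂ (ω + ω') = d₂ ω + d₂ ω' := by
  funext x i j k; simp only [d₂, Pi.add_apply]; ring

/-- **The flux of an integer plaquette field through the cubes of `B_n`**: `q = dm` (the monopole
density of the configuration; FS82 (2.21)–(2.22) `δn`, dually `*dα`).
[cite: FrohlichSpencerCMP1982, §2.4 (2.21)–(2.22)] -/
def fluxMap : (↥(plaquettesIn (halfOpenBox d n)) → ℤ) →+ (↥(cubesIn (halfOpenBox d n)) → ℤ) where
  toFun m c := d₂ (extPlaq m) c.1.1 c.1.2.1 c.1.2.2.1 c.1.2.2.2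
  map_zero' := by
    funext c
    have : extPlaq (0 : ↥(plaquettesIn (halfOpenBox d n)) → ℤ) = 0 := by funext x i j; simp [extPlaq]
    simp [this, d₂]
  map_add' m m' := by funext c; simp [extPlaq_add, d₂_add]

/-- Unfolding `fluxMap`. [folklore] -/
theorem fluxMap_apply (m : ↥(plaquettesIn (halfOpenBox d n)) → ℤ) (c : ↥(cubesIn (halfOpenBox d n))) :
    fluxMap m c = d₂ (extPlaq m) c.1.1 c.1.2.1 c.1.2.2.1 c.1.2.2.2 := rfl

/-- The six faces of a cube of `B_n` are plaquettes of `B_n`. [folklore] -/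
theorem faces_mem {x : ZSite d} {i j k : Fin d} (h : (x, i, j, k) ∈ cubesIn (halfOpenBox d n)) :
    (x, j, k) ∈ plaquettesIn (halfOpenBox d n) ∧ (x + e i, j, k) ∈ plaquettesIn (halfOpenBox d n) ∧
    (x, i, k) ∈ plaquettesIn (halfOpenBox d n) ∧ (x + e j, i, k) ∈ plaquettesIn (halfOpenBox d n) ∧
    (x, i, j) ∈ plaquettesIn (halfOpenBox d n) ∧ (x + e k, i, j) ∈ plaquettesIn (halfOpenBox d n) := by
  obtain ⟨h0, hij, hjk, hi, hj, hk, hij', hik', hjk', hijk⟩ := mem_cubesIn.1 h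
  simp only at h0 hij hjk hi hj hk hij' hik' hjk' hijk
  refine ⟨Plaq.mem_plaquettesIn.2 ⟨h0, hjk, hj, hk, hjk'⟩, Plaq.mem_plaquettesIn.2 ⟨hi, hjk, hij', hik', hijk⟩,
    Plaq.mem_plaquettesIn.2 ⟨h0, hij.trans hjk, hi, hk, hik'⟩,
    Plaq.mem_plaquettesIn.2 ⟨hj, hij.trans hjk, by rwa [add_right_comm] , hjk', by rwa [add_right_comm x (e j) (e i)]⟩,
    Plaq.mem_plaquettesIn.2 ⟨h0, hij, hi, hj, hij'⟩,
    Plaq.mem_plaquettesIn.2 ⟨hk, hij, by rwa [add_right_comm], by rwa [add_right_comm x (e k) (e j)],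
      by rwa [add_right_comm x (e k) (e i), add_right_comm (x + e i) (e k) (e j)]⟩⟩

/-- `d₂` at a cube of `B_n` only reads the plaquettes of `B_n`: two cochains which agree on
`plaquettesIn B_n` have the same flux. [folklore] -/
theorem d₂_congr_of_eqOn {ω ω' : ZSite d → Fin d → Fin d → ℤ}
    (h : ∀ x i j, (x, i, j) ∈ plaquettesIn (halfOpenBox d n) → ω x i j = ω' x i j)
    {x : ZSite d} {i j k : Fin d} (hc : (x, i, j, k) ∈ cubesIn (halfOpenBox d n)) :
    d₂ ω x i j k = d₂ ω' x i j k := by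
  obtain ⟨h1, h2, h3, h4, h5, h6⟩ := faces_mem hc
  simp only [d₂, h _ _ _ h1, h _ _ _ h2, h _ _ _ h3, h _ _ _ h4, h _ _ _ h5, h _ _ _ h6]

/-- **The pure-gauge integers carry no flux**: `fluxMap (dFree ℓ) = 0` (`d ∘ d = 0`).
[cite: FrohlichSpencerCMP1982, §2.3 (2.13)] -/
theorem fluxMap_dFree (ℓ : FreeInt d n) : fluxMap (dFree ℓ) = 0 := by
  funext c
  obtain ⟨⟨x, i, j, k⟩, hc⟩ := c
  rw [fluxMap_apply, Pi.zero_apply]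
  have : d₂ (extPlaq (dFree ℓ)) x i j k = d₂ (d₁ (extFree ℓ)) x i j k :=
    d₂_congr_of_eqOn (fun y a b hy => by rw [extPlaq_apply _ hy]; rfl) hc
  rw [this, d₂_d₁]
  rfl

/-- Box convexity: a site coordinatewise between two sites of `B_n` is in `B_n`. [folklore] -/
theorem mem_halfOpenBox_of_between {x y z : ZSite d} (hx : x ∈ halfOpenBox d n)
    (hz : z ∈ halfOpenBox d n) (h : ∀ m, x m ≤ y m ∧ y m ≤ z m) : y ∈ halfOpenBox d n := by
  rw [mem_halfOpenBox] at hx hz ⊢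
  intro m
  have := h m; have := hx m; have := hz m
  omega

/-- A cube with extreme corners in `B_n` and increasing directions is a cube of `B_n`. [folklore] -/
theorem mem_cubesIn_of_corners {x : ZSite d} {i j k : Fin d} (hij : i < j) (hjk : j < k)
    (hx : x ∈ halfOpenBox d n) (hxijk : x + e i + e j + e k ∈ halfOpenBox d n) :
    (x, i, j, k) ∈ cubesIn (halfOpenBox d n) := by
  have hik : i ≠ k := fun h => by rw [h] at hij; exact lt_asymm hij hjk
  have hij' : i ≠ j := ne_of_lt hij
  have hjk' : j ≠ k := ne_of_lt hjk
  have corner : ∀ y : ZSite d, (∀ m, x m ≤ y m ∧ y m ≤ (x + e i + e j + e k) m) →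
      y ∈ halfOpenBox d n := fun y hy => mem_halfOpenBox_of_between hx hxijk hy
  refine mem_cubesIn.2 ⟨hx, hij, hjk, corner _ ?_, corner _ ?_, corner _ ?_, corner _ ?_,
    corner _ ?_, corner _ ?_, hxijk⟩ <;>
  · intro m
    simp only [Pi.add_apply, LatticeForm.e, Pi.single_apply]
    split_ifs <;> omega

/-- `d₁` at a plaquette only reads its four edges. [folklore] -/
theorem d₁_congr {θ θ' : ZSite d → Fin d → ℤ} {x : ZSite d} {i j : Fin d}
    (h1 : θ x i = θ' x i) (h2 : θ (x + e i) j = θ' (x + e i) j) (h3 : θ (x + e j) i = θ' (x + e j) i)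
    (h4 : θ x j = θ' x j) : d₁ θ x i j = d₁ θ' x i j := by
  simp only [d₁, h1, h2, h3, h4]

/-- **Plaquette fields without flux are pure gauge**: if `fluxMap m = 0` then `m = dFree ℓ` for a
(unique) free integer link field `ℓ` — the relative Poincaré lemma on the box
(`LatticeForm.exists_d₁_eq_of_closed_on_box`) in the comb gauge.
[cite: FrohlichSpencerCMP1982, §2.3 Lemma 1 and §2.4 (2.22)] -/
theorem exists_dFree_eq_of_fluxMap_eq_zero (m : ↥(plaquettesIn (halfOpenBox d n)) → ℤ)
    (hm : fluxMap m = 0) : ∃ ℓ : FreeInt d n, dFree ℓ = m := by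
  classical
  set ω := extPlaq m with hω
  -- closedness on the cubes of the box
  have hcl : ∀ (x : ZSite d) (i j k : Fin d), i.val < j.val → j.val < k.val →
      x ∈ Set.Icc (0 : ZSite d) (top d n) → x + e i + e j + e k ∈ Set.Icc (0 : ZSite d) (top d n) →
      d₂ ω x i j k = 0 := by
    intro x i j k hij hjk hx hxijk
    have hc : (x, i, j, k) ∈ cubesIn (halfOpenBox d n) :=
      mem_cubesIn_of_corners (Fin.lt_def.2 hij) (Fin.lt_def.2 hjk) (mem_halfOpenBox_iff_mem_Icc.2 hx)
        (mem_halfOpenBox_iff_mem_Icc.2 hxijk)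
    have := congrFun hm ⟨(x, i, j, k), hc⟩
    rwa [fluxMap_apply, Pi.zero_apply] at this
  have hθ := exists_d₁_eq_of_closed_on_box ω 0 (top d n) hcl
  set θ := boxPrim₂ ω 0 d with hθdef
  refine ⟨fun e => θ e.1.1.1 e.1.1.2, ?_⟩
  -- `extFree ℓ = θ` on the edges of the box (comb edges: both vanish)
  have hagree : ∀ (y : ZSite d) (a : Fin d), (y, a) ∈ boxEdges d n →
      extFree (fun e : {e : ↥(boxEdges d n) // ¬ IsComb e.1} => θ e.1.1.1 e.1.1.2) y a = θ y a := by
    intro y a hya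
    by_cases hc : IsComb (y, a)
    · rw [extFree_comb _ y a (fun m hm => hc m (Fin.lt_def.2 hm))]
      exact (boxPrim₂_comb ω 0 d le_rfl y a fun m hm => hc m (Fin.lt_def.2 hm)).symm
    · simp [extFree, hya, hc]
  funext p
  obtain ⟨⟨x, i, j⟩, hp⟩ := p
  obtain ⟨h1, h2, h3, h4⟩ := edges_mem_boxEdges hp
  obtain ⟨hij, hx, hxij⟩ := mem_plaquettesIn_iff.1 hp
  rw [dFree_apply]
  simp only
  rw [d₁_congr (hagree _ _ h1) (hagree _ _ h2) (hagree _ _ h3) (hagree _ _ h4),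
    hθ x i j (Fin.lt_def.1 hij) (mem_halfOpenBox_iff_mem_Icc.1 hx) (mem_halfOpenBox_iff_mem_Icc.1 hxij),
    hω, extPlaq_apply m hp]

/-- **The fibres of the flux map**: `range dFree = ker fluxMap`. [cite: FrohlichSpencerCMP1982, §2.4 (2.21)–(2.24)] -/
theorem range_dFree_eq_ker_fluxMap :
    (dFree (d := d) (n := n)).range = (fluxMap (d := d) (n := n)).ker := by
  ext m
  constructor
  · rintro ⟨ℓ, rfl⟩
    exact (AddMonoidHom.mem_ker).2 (fluxMap_dFree ℓ)
  · intro hm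
    obtain ⟨ℓ, hℓ⟩ := exists_dFree_eq_of_fluxMap_eq_zero m ((AddMonoidHom.mem_ker).1 hm)
    exact ⟨ℓ, hℓ⟩

/-! ### The fibre parametrisation and the resummation -/

section Fibre

variable {L N : Type*} [AddCommGroup L] [AddCommGroup N] (φ : L →+ N)

/-- For an injective additive map `φ : L → N`, the (non-canonical) bijection
`N ≃ (N ⧸ range φ) × L`, `x ↦ (⟦x⟧, φ⁻¹(-⟦x⟧.out + x))`, with inverse `(ξ, ℓ) ↦ ξ.out + φ ℓ`.
[folklore] -/
def quotientProdEquiv (hφ : Function.Injective φ) : N ≃ (N ⧸ φ.range) × L where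
  toFun x := ((QuotientAddGroup.mk x : N ⧸ φ.range),
    (AddMonoidHom.ofInjective hφ).symm ⟨-((QuotientAddGroup.mk x : N ⧸ φ.range)).out + x,
      QuotientAddGroup.eq.1 (QuotientAddGroup.out_eq' _)⟩)
  invFun p := p.1.out + φ p.2
  left_inv x := by
    have h1 : (φ ((AddMonoidHom.ofInjective hφ).symm ⟨-((QuotientAddGroup.mk x : N ⧸ φ.range)).out + x,
        QuotientAddGroup.eq.1 (QuotientAddGroup.out_eq' _)⟩) : N) =
        -((QuotientAddGroup.mk x : N ⧸ φ.range)).out + x :=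
      congrArg Subtype.val ((AddMonoidHom.ofInjective hφ).apply_symm_apply _)
    dsimp only
    rw [h1, add_neg_cancel_left]
  right_inv p := by
    obtain ⟨ξ, ℓ⟩ := p
    have hmk : (QuotientAddGroup.mk (ξ.out + φ ℓ) : N ⧸ φ.range) = ξ := by
      conv_rhs => rw [← QuotientAddGroup.out_eq' ξ]
      rw [eq_comm, QuotientAddGroup.eq, neg_add_cancel_left]
      exact ⟨ℓ, rfl⟩
    have hout : ((QuotientAddGroup.mk (ξ.out + φ ℓ) : N ⧸ φ.range)).out = ξ.out := by rw [hmk]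
    refine Prod.ext hmk ?_
    dsimp only
    rw [AddEquiv.symm_apply_eq]
    apply Subtype.ext
    rw [AddMonoidHom.ofInjective_apply]
    change -((QuotientAddGroup.mk (ξ.out + φ ℓ) : N ⧸ φ.range)).out + (ξ.out + φ ℓ) = φ ℓ
    rw [hout, neg_add_cancel_left]

/-- The inverse of `quotientProdEquiv`: `(ξ, ℓ) ↦ ξ.out + φ ℓ`. [folklore] -/
@[simp] theorem quotientProdEquiv_symm_apply (hφ : Function.Injective φ) (p : (N ⧸ φ.range) × L) :
    (quotientProdEquiv φ hφ).symm p = p.1.out + φ p.2 := rfl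

/-- The first component of `quotientProdEquiv` is the class. [folklore] -/
@[simp] theorem quotientProdEquiv_apply_fst (hφ : Function.Injective φ) (x : N) :
    ((quotientProdEquiv φ hφ) x).1 = (QuotientAddGroup.mk x : N ⧸ φ.range) := rfl

/-- **Resummation over the fibres**: for an absolutely summable family on `N`,
`∑_{x ∈ N} Φ(x) = ∑_{ξ ∈ N/φ(L)} ∑_{ℓ ∈ L} Φ(ξ.out + φ ℓ)`. [folklore] -/
theorem tsum_eq_tsum_tsum_quotient (hφ : Function.Injective φ) {E : Type*} [NormedAddCommGroup E]
    [CompleteSpace E] (Φ : N → E) (hΦ : Summable fun x => ‖Φ x‖) :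
    ∑' x, Φ x = ∑' ξ : N ⧸ φ.range, ∑' ℓ : L, Φ (ξ.out + φ ℓ) := by
  have h1 : ∑' p : (N ⧸ φ.range) × L, Φ ((quotientProdEquiv φ hφ).symm p) = ∑' x, Φ x :=
    Equiv.tsum_eq _ Φ
  rw [← h1]
  have hs : Summable fun p : (N ⧸ φ.range) × L => Φ ((quotientProdEquiv φ hφ).symm p) := by
    refine Summable.of_norm ?_
    exact (Equiv.summable_iff (quotientProdEquiv φ hφ).symm (f := fun x => ‖Φ x‖)).2 hΦ
  rw [hs.tsum_prod]
  rfl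

end Fibre

/-- **The fibre parametrisation of the Villain integers**: integer plaquette fields of the cube
`≃` (flux classes) `×` (free integer link fields), `(ξ, ℓ) ↦ ξ.out + dℓ`.
[cite: FrohlichSpencerCMP1982, §2.4 (2.21)–(2.24)] -/
def fibreEquiv : (↥(plaquettesIn (halfOpenBox d n)) → ℤ) ≃
    ((↥(plaquettesIn (halfOpenBox d n)) → ℤ) ⧸ (dFree (d := d) (n := n)).range) × FreeInt d n :=
  quotientProdEquiv dFree dFree_injective

/-- `fibreEquiv.symm (ξ, ℓ) = ξ.out + dFree ℓ`. [folklore] -/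
@[simp] theorem fibreEquiv_symm_apply
    (p : ((↥(plaquettesIn (halfOpenBox d n)) → ℤ) ⧸ (dFree (d := d) (n := n)).range) × FreeInt d n) :
    (fibreEquiv (d := d) (n := n)).symm p = p.1.out + dFree p.2 := rfl

/-- **The flux of a class** (well defined since `fluxMap (dFree ℓ) = 0`). [cite: FrohlichSpencerCMP1982, §2.4 (2.21)] -/
def fluxQuot : ((↥(plaquettesIn (halfOpenBox d n)) → ℤ) ⧸ (dFree (d := d) (n := n)).range) →+
    (↥(cubesIn (halfOpenBox d n)) → ℤ) :=
  QuotientAddGroup.lift _ fluxMap (by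
    rintro m ⟨ℓ, rfl⟩
    exact (AddMonoidHom.mem_ker).2 (fluxMap_dFree ℓ))

/-- `fluxQuot ⟦m⟧ = fluxMap m`. [folklore] -/
@[simp] theorem fluxQuot_mk (m : ↥(plaquettesIn (halfOpenBox d n)) → ℤ) :
    fluxQuot (QuotientAddGroup.mk m) = fluxMap m := rfl

/-- `fluxMap ξ.out = fluxQuot ξ`. [folklore] -/
theorem fluxMap_out (ξ : (↥(plaquettesIn (halfOpenBox d n)) → ℤ) ⧸ (dFree (d := d) (n := n)).range) :
    fluxMap ξ.out = fluxQuot ξ := by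
  conv_rhs => rw [← QuotientAddGroup.out_eq' ξ]
  rfl

/-- **Classes are determined by their flux**: `fluxQuot` is injective (the relative Poincaré
lemma). [cite: FrohlichSpencerCMP1982, §2.3 Lemma 1 and §2.4 (2.22)] -/
theorem fluxQuot_injective : Function.Injective (fluxQuot (d := d) (n := n)) := by
  intro ξ ξ' h
  induction ξ using QuotientAddGroup.induction_on with
  | H m =>
    induction ξ' using QuotientAddGroup.induction_on with
    | H m' =>
      rw [fluxQuot_mk, fluxQuot_mk] at h
      refine QuotientAddGroup.eq.2 ?_
      rw [range_dFree_eq_ker_fluxMap, AddMonoidHom.mem_ker, map_add, map_neg, h, neg_add_cancel]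

/-- **Resummation of the Villain integers over the fibres of the flux map**: for an absolutely
summable family `Φ` of integer plaquette fields of the cube,
`∑_m Φ(m) = ∑_{ξ} ∑_{ℓ ∈ ℤ^{free edges}} Φ(ξ.out + dℓ)`, the outer sum running over the flux
classes (equivalently, by `fluxQuot_injective`, over the fluxes `q = dm`).
[cite: FrohlichSpencerCMP1982, §2.4 (2.21)–(2.24)] -/
theorem tsum_eq_tsum_tsum_fibre {E : Type*} [NormedAddCommGroup E] [CompleteSpace E]
    (Φ : (↥(plaquettesIn (halfOpenBox d n)) → ℤ) → E) (hΦ : Summable fun m => ‖Φ m‖) :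
    ∑' m, Φ m = ∑' ξ : (↥(plaquettesIn (halfOpenBox d n)) → ℤ) ⧸ (dFree (d := d) (n := n)).range,
      ∑' ℓ : FreeInt d n, Φ (ξ.out + dFree ℓ) :=
  tsum_eq_tsum_tsum_quotient dFree dFree_injective Φ hΦ

end VillainFibre

end Literature.MathematicalPhysics.QuantumFieldTheory
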